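import Summits.ValiantsHypothesis.ValiantsHypothesis.Theorems.DefinabilityGapPrimePencil
import HarnessLib

/-!
# DefinabilityGap — `G_m` hits depth-3 circuits with top fan-in 2 (ΣΠΣ(2)), of every size and degree

Route `route-ValiantsHypothesis-DefinabilityGap` (decomp-valiant cycle 1, lens 5: hardness–randomness / PIT axis); size road
of the residual `KIPlantedHitting` (stmt-ValiantsHypothesis-23547; census cells W5 / W19), read-once leaf F4 / W10
(`KIPlantedHittingRO`, stmt-ValiantsHypothesis-23704). `G_m : y ↦ (P_c(y))_c`, `P_c = kiPer m c`, `φ = bind₁ (kiPer m)`.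

A SIZE-FREE depth-3 rung, strictly above the width-2 diagonal rung S0 of F4 / W10: for `m ≥ 3` and any two multisets
`S₁, S₂` of AFFINE forms `ℓ` (total degree `≤ 1`) in the block variables, `D = ∏ S₁ + ∏ S₂ ≠ 0 ⇒ D(G_m) ≠ 0`
(`kiPer_hits_sigmaPiSigmaTwo`). Mechanism (prime-by-prime matching): by the prime pencil
(`DefinabilityGapPrimePencil.kiPer_pencil_prime`) the image `φ ℓ = C ℓ(0) + ∑_c C ℓ_c · P_c` of an affine form is `0`, a unit,
or PRIME, and `φ` is injective on affine forms; if `φ(∏ S₁) = −φ(∏ S₂) ≠ 0`, unique factorisation in `ℂ[y]` matches the prime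
images one by one (`Prime.exists_mem_multiset_dvd`), associated prime images come from proportional forms, and by induction
`∏ S₁ = C μ · ∏ S₂` with `μ = −1`, i.e. `D = 0`. The honest ceiling: bounded top fan-in only — top fan-in 3 already needs
rank bounds `E(≥ 18)` (Saxena–Seshadhri 2013 Thm 4) and poly-size ΣΠΣ an annihilator-uniform bound (IDEA-NEEDED); clause
`b ≥ 2` of `KIPlantedHitting` untouched. 0 sorry.
-/

noncomputable section

open MvPolynomial
open Literature.Computability.AlgebraicComplexity Literature.Computability.MetaComplexity

namespace Summit.ValiantsHypothesis.ValiantsHypothesis.Theorems.DefinabilityGapSigmaPiSigmaTwo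

open Summit.ValiantsHypothesis.ValiantsHypothesis.Theorems.DefinabilityGapAffineRung
open Summit.ValiantsHypothesis.ValiantsHypothesis.Theorems.DefinabilityGapZeroedBlocks
open Summit.ValiantsHypothesis.ValiantsHypothesis.Theorems.DefinabilityGapPrimePencilPatterns
open Summit.ValiantsHypothesis.ValiantsHypothesis.Theorems.DefinabilityGapPrimePencil

variable {m : ℕ}

/-! ## 1. Affine forms -/

/-- An exponent vector of degree `≤ 1` is `0` or a single variable. [folklore] -/
theorem eq_zero_or_eq_single_of_degree_le_one {σ : Type*} (d : σ →₀ ℕ) (hd : (d.sum fun _ e => e) ≤ 1) :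
    d = 0 ∨ ∃ c, d = Finsupp.single c 1 := by
  classical
  by_cases h0 : d = 0
  · exact Or.inl h0
  right
  obtain ⟨c, hc⟩ := Finsupp.ne_iff.1 h0
  rw [Finsupp.zero_apply] at hc
  have hcs : c ∈ d.support := Finsupp.mem_support_iff.2 hc
  simp only [Finsupp.sum] at hd
  have h1 : d c ≤ 1 := (Finset.single_le_sum (fun _ _ => Nat.zero_le _) hcs).trans hd
  refine ⟨c, Finsupp.eq_single_iff.2 ⟨fun c' hc' => Finset.mem_singleton.2 ?_, by omega⟩⟩
  by_contra hne
  have hsub : ({c', c} : Finset σ) ⊆ d.support := by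
    rw [Finset.insert_subset_iff, Finset.singleton_subset_iff]
    exact ⟨hc', hcs⟩
  have h2 := Finset.sum_le_sum_of_subset_of_nonneg hsub (f := fun k => d k) fun _ _ _ => Nat.zero_le _
  rw [Finset.sum_pair hne] at h2
  have h3 := Finsupp.mem_support_iff.1 hc'
  omega

/-- **Affine normal form**: a polynomial of total degree `≤ 1` is `p = p(0) + ∑_c p_c · X_c`. [folklore] -/
theorem eq_C_add_sum_of_totalDegree_le_one {σ R : Type*} [Fintype σ] [CommSemiring R] (p : MvPolynomial σ R)
    (hp : p.totalDegree ≤ 1) : p = C (coeff 0 p) + ∑ c, C (coeff (Finsupp.single c 1) p) * X c := by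
  classical
  apply MvPolynomial.ext
  intro d
  simp only [coeff_add, coeff_C, coeff_sum, coeff_C_mul, coeff_X]
  rcases em (d ∈ p.support) with hd | hd
  · rcases eq_zero_or_eq_single_of_degree_le_one d ((le_totalDegree hd).trans hp) with rfl | ⟨c, rfl⟩
    · rw [if_pos rfl, Finset.sum_eq_zero, add_zero]
      intro c _
      rw [if_neg (Finsupp.single_ne_zero.2 one_ne_zero), mul_zero]
    · rw [if_neg (Ne.symm (Finsupp.single_ne_zero.2 one_ne_zero)), zero_add, Finset.sum_eq_single c,
        if_pos rfl, mul_one]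
      · intro c' _ hc'
        rw [if_neg (fun h => hc' (Finsupp.single_left_injective one_ne_zero h)), mul_zero]
      · intro h
        exact absurd (Finset.mem_univ c) h
  · have h0 : coeff d p = 0 := notMem_support_iff.1 hd
    rw [h0]
    have t1 : (if (0 : σ →₀ ℕ) = d then coeff 0 p else 0) = 0 := by
      split_ifs with h
      · rw [h]; exact h0
      · rfl
    rw [t1, zero_add]
    symm
    refine Finset.sum_eq_zero fun c _ => ?_
    split_ifs with h
    · rw [h, h0, zero_mul]
    · exact mul_zero _

/-- Substitution into an affine form. [folklore] -/
theorem bind₁_of_totalDegree_le_one {σ τ R : Type*} [Fintype σ] [CommSemiring R] (f : σ → MvPolynomial τ R)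
    (p : MvPolynomial σ R) (hp : p.totalDegree ≤ 1) :
    bind₁ f p = C (coeff 0 p) + ∑ c, C (coeff (Finsupp.single c 1) p) * f c := by
  conv_lhs => rw [eq_C_add_sum_of_totalDegree_le_one p hp]
  simp only [map_add, map_sum, map_mul, bind₁_C_right, bind₁_X_right]

/-- An affine form without linear part is a constant. [folklore] -/
theorem exists_eq_C_of_totalDegree_le_one {σ R : Type*} [Fintype σ] [CommSemiring R] {p : MvPolynomial σ R}
    (hp : p.totalDegree ≤ 1) (hlin : ∀ c, coeff (Finsupp.single c 1) p = 0) : ∃ β : R, p = C β := by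
  refine ⟨coeff 0 p, ?_⟩
  conv_lhs => rw [eq_C_add_sum_of_totalDegree_le_one p hp]
  simp only [hlin, C_0, zero_mul, Finset.sum_const_zero, add_zero]

/-! ## 2. Images of affine forms under `G_m`: zero, unit, or prime; injectivity; rigidity -/

/-- **An affine form with a linear part maps to a PRIME** under `φ = bind₁ (kiPer m)` (`m ≥ 3`): its image is a member of
the prime pencil. [this file] -/
theorem prime_bind₁_kiPer_of_totalDegree_le_one (hm : 3 ≤ m) {p : MvPolynomial (Fin 3 → Fin (qOf m)) ℂ}
    (hp : p.totalDegree ≤ 1) (hlin : ∃ c, coeff (Finsupp.single c 1) p ≠ 0) : Prime (bind₁ (kiPer m) p) := by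
  rw [bind₁_of_totalDegree_le_one (kiPer m) p hp]
  refine kiPer_pencil_prime hm (fun c => coeff (Finsupp.single c 1) p) (fun h => ?_) (coeff 0 p)
  obtain ⟨c, hc⟩ := hlin
  exact hc (congrFun h c)

/-- **`φ` is injective on affine forms** (`m ≥ 3`). [this file] -/
theorem eq_zero_of_bind₁_kiPer_eq_zero (hm : 3 ≤ m) {p : MvPolynomial (Fin 3 → Fin (qOf m)) ℂ}
    (hp : p.totalDegree ≤ 1) (h0 : bind₁ (kiPer m) p = 0) : p = 0 := by
  by_cases hlin : ∀ c, coeff (Finsupp.single c 1) p = 0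
  · obtain ⟨β, rfl⟩ := exists_eq_C_of_totalDegree_le_one hp hlin
    rw [bind₁_C_right, C_eq_zero] at h0
    rw [h0, C_0]
  · push Not at hlin
    exact absurd h0 (prime_bind₁_kiPer_of_totalDegree_le_one hm hp hlin).ne_zero

/-- An affine form whose image is a unit is a non-zero constant (`m ≥ 3`). [this file] -/
theorem exists_eq_C_of_isUnit_bind₁_kiPer (hm : 3 ≤ m) {p : MvPolynomial (Fin 3 → Fin (qOf m)) ℂ}
    (hp : p.totalDegree ≤ 1) (hu : IsUnit (bind₁ (kiPer m) p)) : ∃ β : ℂ, β ≠ 0 ∧ p = C β := by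
  by_cases hlin : ∀ c, coeff (Finsupp.single c 1) p = 0
  · obtain ⟨β, rfl⟩ := exists_eq_C_of_totalDegree_le_one hp hlin
    refine ⟨β, ?_, rfl⟩
    rintro rfl
    rw [C_0, map_zero] at hu
    exact not_isUnit_zero hu
  · push Not at hlin
    exact absurd hu (prime_bind₁_kiPer_of_totalDegree_le_one hm hp hlin).not_unit

/-- **Rigidity**: affine forms with associated images are proportional (`m ≥ 3`). [this file] -/
theorem exists_eq_C_mul_of_associated (hm : 3 ≤ m) {p p' : MvPolynomial (Fin 3 → Fin (qOf m)) ℂ}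
    (hp : p.totalDegree ≤ 1) (hp' : p'.totalDegree ≤ 1)
    (h : Associated (bind₁ (kiPer m) p) (bind₁ (kiPer m) p')) : ∃ ω : ℂ, ω ≠ 0 ∧ p' = C ω * p := by
  obtain ⟨u, hu⟩ := h
  obtain ⟨ω, hωu, hωC⟩ := MvPolynomial.isUnit_iff_eq_C_of_isReduced.1 u.isUnit
  refine ⟨ω, hωu.ne_zero, ?_⟩
  have hr : (p' - C ω * p).totalDegree ≤ 1 := by
    refine (totalDegree_sub _ _).trans (max_le hp' ((totalDegree_mul _ _).trans ?_))
    rw [totalDegree_C, zero_add]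
    exact hp
  have h0 : bind₁ (kiPer m) (p' - C ω * p) = 0 := by
    rw [map_sub, map_mul, bind₁_C_right, ← hωC, ← hu, mul_comm, sub_self]
  exact sub_eq_zero.1 (eq_zero_of_bind₁_kiPer_eq_zero hm hr h0)

/-! ## 3. Prime-by-prime matching of products of affine forms -/

/-- A product of affine forms whose image is a unit is a non-zero constant (`m ≥ 3`). [this file] -/
theorem exists_prod_eq_C_of_isUnit (hm : 3 ≤ m) (S : Multiset (MvPolynomial (Fin 3 → Fin (qOf m)) ℂ)) :
    (∀ p ∈ S, p.totalDegree ≤ 1) → IsUnit (bind₁ (kiPer m) S.prod) → ∃ ν : ℂ, ν ≠ 0 ∧ S.prod = C ν := by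
  induction S using Multiset.induction_on with
  | empty =>
    intro _ _
    exact ⟨1, one_ne_zero, by rw [Multiset.prod_zero, C_1]⟩
  | cons p T ih =>
    intro hS hu
    rw [Multiset.prod_cons, map_mul] at hu
    have hup : IsUnit (bind₁ (kiPer m) p) := isUnit_of_mul_isUnit_left hu
    have huT : IsUnit (bind₁ (kiPer m) T.prod) := isUnit_of_mul_isUnit_right hu
    obtain ⟨β, hβ, rfl⟩ := exists_eq_C_of_isUnit_bind₁_kiPer hm (hS p (Multiset.mem_cons_self _ _)) hup
    obtain ⟨ν, hν, hT⟩ := ih (fun r hr => hS r (Multiset.mem_cons_of_mem hr)) huT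
    exact ⟨β * ν, mul_ne_zero hβ hν, by rw [Multiset.prod_cons, hT, C_mul]⟩

/-- **Matching lemma.** If the images of two products of affine forms are associated and non-zero, the products are
proportional (`m ≥ 3`): primes are matched one by one through unique factorisation in `ℂ[y]`, units are constants.
[this file] -/
theorem exists_prod_eq_C_mul_prod (hm : 3 ≤ m) (S₁ : Multiset (MvPolynomial (Fin 3 → Fin (qOf m)) ℂ)) :
    ∀ S₂ : Multiset (MvPolynomial (Fin 3 → Fin (qOf m)) ℂ),
      (∀ p ∈ S₁, p.totalDegree ≤ 1) → (∀ p ∈ S₂, p.totalDegree ≤ 1) → bind₁ (kiPer m) S₁.prod ≠ 0 →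
      Associated (bind₁ (kiPer m) S₁.prod) (bind₁ (kiPer m) S₂.prod) →
      ∃ μ : ℂ, μ ≠ 0 ∧ S₁.prod = C μ * S₂.prod := by
  induction S₁ using Multiset.induction_on with
  | empty =>
    intro S₂ _ h₂ _ hassoc
    rw [Multiset.prod_zero, map_one] at hassoc
    obtain ⟨ν, hν, hS₂⟩ := exists_prod_eq_C_of_isUnit hm S₂ h₂ (associated_one_iff_isUnit.1 hassoc.symm)
    refine ⟨ν⁻¹, inv_ne_zero hν, ?_⟩
    rw [Multiset.prod_zero, hS₂, ← C_mul, inv_mul_cancel₀ hν, C_1]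
  | cons p T ih =>
    intro S₂ h₁ h₂ hne hassoc
    have hp : p.totalDegree ≤ 1 := h₁ p (Multiset.mem_cons_self _ _)
    have hT : ∀ r ∈ T, r.totalDegree ≤ 1 := fun r hr => h₁ r (Multiset.mem_cons_of_mem hr)
    rw [Multiset.prod_cons, map_mul] at hne hassoc
    have hp0 : bind₁ (kiPer m) p ≠ 0 := left_ne_zero_of_mul hne
    have hT0 : bind₁ (kiPer m) T.prod ≠ 0 := right_ne_zero_of_mul hne
    by_cases hlin : ∀ c, coeff (Finsupp.single c 1) p = 0
    · -- `p` is a non-zero constant: drop it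
      obtain ⟨β, rfl⟩ := exists_eq_C_of_totalDegree_le_one hp hlin
      rw [bind₁_C_right] at hp0 hassoc
      have hβ : β ≠ 0 := fun h => hp0 (by rw [h, C_0])
      have hassoc' : Associated (bind₁ (kiPer m) T.prod) (bind₁ (kiPer m) S₂.prod) :=
        (associated_unit_mul_left _ _ ((isUnit_iff_ne_zero.2 hβ).map C)).symm.trans hassoc
      obtain ⟨μ, hμ, hTprod⟩ := ih S₂ hT h₂ hT0 hassoc'
      refine ⟨β * μ, mul_ne_zero hβ hμ, ?_⟩
      rw [Multiset.prod_cons, hTprod, ← mul_assoc, ← C_mul]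
    · -- `p` maps to a prime: match it with a factor of `S₂`
      push Not at hlin
      have hP : Prime (bind₁ (kiPer m) p) := prime_bind₁_kiPer_of_totalDegree_le_one hm hp hlin
      have hdvd : bind₁ (kiPer m) p ∣ (S₂.map (bind₁ (kiPer m))).prod := by
        rw [← map_multiset_prod]
        exact (dvd_mul_right _ _).trans hassoc.dvd
      obtain ⟨x, hx, hpx⟩ := hP.exists_mem_multiset_dvd hdvd
      obtain ⟨p', hp'S, rfl⟩ := Multiset.mem_map.1 hx
      have hp' : p'.totalDegree ≤ 1 := h₂ p' hp'S
      obtain ⟨T₂, rfl⟩ := Multiset.exists_cons_of_mem hp'S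
      have hT₂ : ∀ r ∈ T₂, r.totalDegree ≤ 1 := fun r hr => h₂ r (Multiset.mem_cons_of_mem hr)
      rw [Multiset.prod_cons, map_mul] at hassoc
      have hS₂0 : bind₁ (kiPer m) p' * bind₁ (kiPer m) T₂.prod ≠ 0 := fun h => hne (hassoc.eq_zero_iff.2 h)
      have hp'0 : bind₁ (kiPer m) p' ≠ 0 := left_ne_zero_of_mul hS₂0
      have hlin' : ∃ c, coeff (Finsupp.single c 1) p' ≠ 0 := by
        by_contra hcon
        push Not at hcon
        obtain ⟨β, rfl⟩ := exists_eq_C_of_totalDegree_le_one hp' hcon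
        rw [bind₁_C_right] at hpx hp'0
        have hβ : β ≠ 0 := fun h => hp'0 (by rw [h, C_0])
        exact hP.not_unit (isUnit_of_dvd_unit hpx ((isUnit_iff_ne_zero.2 hβ).map C))
      have hP' : Prime (bind₁ (kiPer m) p') := prime_bind₁_kiPer_of_totalDegree_le_one hm hp' hlin'
      have hpp' : Associated (bind₁ (kiPer m) p) (bind₁ (kiPer m) p') :=
        hP.irreducible.associated_of_dvd hP'.irreducible hpx
      obtain ⟨ω, hω, hp'eq⟩ := exists_eq_C_mul_of_associated hm hp hp' hpp'
      have hTT : Associated (bind₁ (kiPer m) T.prod) (bind₁ (kiPer m) T₂.prod) := hassoc.of_mul_left hpp' hp0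
      obtain ⟨μ, hμ, hTprod⟩ := ih T₂ hT hT₂ hT0 hTT
      refine ⟨μ * ω⁻¹, mul_ne_zero hμ (inv_ne_zero hω), ?_⟩
      rw [Multiset.prod_cons, Multiset.prod_cons, hTprod, hp'eq]
      calc p * (C μ * T₂.prod) = C (μ * ω⁻¹ * ω) * p * T₂.prod := by rw [inv_mul_cancel_right₀ hω]; ring
        _ = C (μ * ω⁻¹) * (C ω * p * T₂.prod) := by simp only [C_mul]; ring

/-! ## 4. The rung -/

/-- **`G_m` hits ΣΠΣ(2)** (`m ≥ 3`): for any two multisets of affine forms in the block variables, if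
`D = ∏ S₁ + ∏ S₂ ≠ 0` then `D(G_m) ≠ 0` — every size, every degree. [this file] -/
theorem kiPer_hits_sigmaPiSigmaTwo (hm : 3 ≤ m) (S₁ S₂ : Multiset (MvPolynomial (Fin 3 → Fin (qOf m)) ℂ))
    (h₁ : ∀ p ∈ S₁, p.totalDegree ≤ 1) (h₂ : ∀ p ∈ S₂, p.totalDegree ≤ 1) (hD : S₁.prod + S₂.prod ≠ 0) :
    MvPolynomial.bind₁ (kiPer m) (S₁.prod + S₂.prod) ≠ 0 := by
  classical
  intro h0
  rw [map_add] at h0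
  have hAB : bind₁ (kiPer m) S₁.prod = -bind₁ (kiPer m) S₂.prod := eq_neg_of_add_eq_zero_left h0
  by_cases hA : bind₁ (kiPer m) S₁.prod = 0
  · -- then a factor of `S₁` vanishes, `D = ∏ S₂ ≠ 0`, and no factor of `S₂` vanishes
    have hB : bind₁ (kiPer m) S₂.prod = 0 := by
      rw [hA] at hAB
      exact neg_eq_zero.1 hAB.symm
    rw [map_multiset_prod, Multiset.prod_eq_zero_iff, Multiset.mem_map] at hA hB
    obtain ⟨p, hp, hp0⟩ := hA
    have hS₁ : S₁.prod = 0 := Multiset.prod_eq_zero (eq_zero_of_bind₁_kiPer_eq_zero hm (h₁ p hp) hp0 ▸ hp)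
    rw [hS₁, zero_add] at hD
    obtain ⟨p', hp', hp'0⟩ := hB
    exact hD (Multiset.prod_eq_zero (eq_zero_of_bind₁_kiPer_eq_zero hm (h₂ p' hp') hp'0 ▸ hp'))
  · have hB : bind₁ (kiPer m) S₂.prod ≠ 0 := fun hB => hA (by rw [hAB, hB, neg_zero])
    have hassoc : Associated (bind₁ (kiPer m) S₁.prod) (bind₁ (kiPer m) S₂.prod) := by
      rw [hAB]
      exact ⟨-1, by simp⟩
    obtain ⟨μ, -, hprod⟩ := exists_prod_eq_C_mul_prod hm S₁ S₂ h₁ h₂ hA hassoc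
    have hφ : bind₁ (kiPer m) S₁.prod = C μ * bind₁ (kiPer m) S₂.prod := by rw [hprod, map_mul, bind₁_C_right]
    have hμ1 : μ + 1 = 0 := by
      have h1 : (C (μ + 1) : MvPolynomial (Fin (qOf m) × Fin (qOf m)) ℂ) * bind₁ (kiPer m) S₂.prod = 0 := by
        rw [C_add, C_1, add_mul, one_mul, ← hφ, hAB, neg_add_cancel]
      rcases mul_eq_zero.1 h1 with h | h
      · exact C_eq_zero.1 h
      · exact absurd h hB
    apply hD
    calc S₁.prod + S₂.prod = C (μ + 1) * S₂.prod := by rw [hprod, C_add, C_1, add_mul, one_mul]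
      _ = 0 := by rw [hμ1, C_0, zero_mul]

end Summit.ValiantsHypothesis.ValiantsHypothesis.Theorems.DefinabilityGapSigmaPiSigmaTwo
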